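import Mathlib
import HarnessLib

/-!
# Handelman certificates for quadratic polynomials on the hypercube: the de Klerk–Laurent
# error bounds via Bernstein approximation (de Klerk–Laurent 2010, §1.3 and §2, Theorem 2.1)

Topic `Literature/Algebra/Polynomial`, namespace
`Literature.Algebra.Polynomial.HandelmanHypercubeQuadratic`.  Self-contained (Mathlib's
`bernsteinPolynomial` with its moment identities `bernsteinPolynomial.sum`, `.sum_smul`,
`.sum_mul_smul`); the products `∏ xᵢ^{aᵢ} (1 − xᵢ)^{bᵢ}` are written exactly as in
`Literature.Algebra.Polynomial.handelman_cube_degree` (`PolyaPositivstellensatz.lean`), indexed by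
`β : ι ⊕ ι →₀ ℕ`.

## Source, read on the page

E. de Klerk, M. Laurent, *Error bounds for some semidefinite programming approaches to polynomial
minimization on the hypercube*, SIAM J. Optim. 20 (2010) 3104–3120 [held text
`paper:doi-10-1137-100790835`, pp. 4–10].  `Q = [0,1]ⁿ`, `g` = the `2n` linear polynomials
`x₁, 1 − x₁, …, xₙ, 1 − xₙ` (1.5).

* (1.9) «`H_r(g) := {Σ_{k ∈ ℕ^{2n}} λ_k g^k | deg(λ_k g^k) ≤ r, λ_k ∈ ℝ₊}`» (the truncated preprime;
  `g^k = g₁^{k₁}⋯g_{2n}^{k_{2n}}`), (1.11) «`p^{(r)}_{han,g} := sup {t | p − t ∈ H_r(g)}`»,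
  (1.13) `p^{(r)}_{han} ≤ p^{(r)}_{sch} ≤ p_{min}`; (1.14) `p_{min,Q(d)} := min_{x ∈ Q(d)} p(x)`,
  `Q(d) = {x ∈ Q | dx ∈ ℕⁿ}`.
* §1.3: the Bernstein basis `p_{d,k} = C(d,k) x^k (1−x)^{d−k}` (1.16), (1.17)
  «`B_d(x²) = x² + (1/d) x(1 − x)`», the multivariate `P_{d,k} = Π p_{d,kᵢ}(xᵢ)` (1.19), (1.20)
  «`Σ_k P_{d,k} = 1`», the Bernstein approximation
  «`B_d(f) := Σ_{k ∈ [d]₀ⁿ} f(k/d) P_{d,k}`», multiplicativity on products of functions in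
  disjoint variables, and «each `P_{d,k}` belongs to `H_{dn}(g)`».
* §2, (2.2) «`B_d(p) = p + (1/d) Σᵢ Aᵢᵢ xᵢ(1 − xᵢ)`» for `p = xᵀAx + bᵀx + c`; (2.1)
  `I₊ = {i | Aᵢᵢ > 0}`, `I₋ = {i | Aᵢᵢ < 0}`; the identity (2.3)
  «`p − p_{min,Q} = B_d(p − p_{min,Q}) + q₁ + q₂ − C(d,p)`», `q₁ = (1/d) Σ_{I₋} |Aᵢᵢ| xᵢ(1−xᵢ)`,
  `q₂ = (1/d) Σ_{I₊} Aᵢᵢ ((xᵢ − 1)² + xᵢ)`, `C(d,p) = (1/d) Σ_{I₊} Aᵢᵢ` («we used the identity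
  `−xᵢ(1 − xᵢ) = (xᵢ − 1)² + xᵢ − 1`»), `B_d(p − p_{min,Q}) ∈ H_{dn}(g)`, `q₁, q₂ ∈ H₂(g)`.
* **Theorem 2.1.** «Let `p = xᵀAx + bᵀx + c` be a quadratic polynomial […].
  (i) For any integer `d ≥ 1`, `p − p_{min,Q} + (1/d) Σ_{i∈I₊} Aᵢᵢ ∈ H_r(g)` for some integer
  `r ≤ max(dn, 2)`.
  (ii) If `p` is positive on the hypercube `Q`, then `p ∈ H_r(g)` for some integer
  `r ≤ max(n d_p, 2)`, where `d_p := ⌈Σ_{i∈I₊} Aᵢᵢ / p_{min,Q}⌉`.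
  (iii) For any integer `d ≥ 2`, […] `p_{min,Q} − p^{(dn)}_{han,g} ≤ […] ≤ (1/d) Σ_{I₊} Aᵢᵢ`.
  (iv) For any integer `d ≥ 2`, `p_{min,Q(d)} − p_{min,Q} ≤ (1/(4d)) Σ_{I₊} Aᵢᵢ`.»
  Proof (p. 9): (i) «follows directly from (2.3)»; (ii) «after choosing for `d` the smallest integer
  making the constant `p_{min,Q} − (1/d)Σ_{I₊}Aᵢᵢ` nonnegative»; (iv) «use again the identity
  `p = B_d(p) + q₁ + q₂ − C(d,p)`, together with `B_d(p) ≥ p_{min,Q(d)}`, `q₁ ≥ 0` and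
  `q₂ ≥ (3/4) C(d,p)` on `Q`, which follows from the fact that `(xᵢ − 1)² + xᵢ ≥ 3/4` on `[0,1]`».

## What is formalised (all proved; no named facts, no `sorry`)

Over a linearly ordered field `𝕜`, variables indexed by a finite type `ι` (`n = |ι|`):

* §1 the cone `H_r(g)` as an inductive predicate `IsHandelmanCube r` (generated by the
  `λ · ∏ xᵢ^{β(inl i)} (1 − xᵢ)^{β(inr i)}`, `λ ≥ 0`, `|β| ≤ r`, under `+`), its closure
  properties, the explicit-sum description (`IsHandelmanCube.exists_sum`,
  `isHandelmanCube_sum`) and soundness (`IsHandelmanCube.eval_nonneg`: members are `≥ 0` on `Q`,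
  whence `p^{(r)}_{han} ≤ p_{min}`, `le_eval_of_isHandelmanCube_sub_C`).
* §2 the Bernstein operator `bernsteinOp d p = Σ_k p(k/d) P_{d,k}` on polynomials, (1.20),
  `B_d(1) = 1`, `B_d(xᵢ) = xᵢ`, `B_d(xᵢxⱼ) = xᵢxⱼ` (`i ≠ j`), (1.17) `B_d(xᵢ²) = xᵢ² + xᵢ(1−xᵢ)/d`,
  linearity, `B_d(p) ∈ H_{dn}(g)` when `p ≥ 0` on `Q(d)`, and `B_d(p) ≥ p_{min,Q(d)}` on `Q`.
* §3 for `p = xᵀAx + bᵀx + c` (`quadPoly A b c`): ★ (2.2) `bernsteinOp_quadPoly`, ★ the identity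
  (2.3) `quadPoly_eq_bernsteinOp_add`, ★★ **Theorem 2.1 (i)** `isHandelmanCube_quadPoly_sub_C`
  (with `p_{min,Q}` replaced by any `λ ≤ p` on the grid `Q(d)` — in particular any `λ ≤ p_{min,Q}`),
  ★★ **(ii)** `isHandelmanCube_quadPoly_of_pos` (`p ≥ λ > 0` on `Q`, `Σ_{I₊}Aᵢᵢ ≤ λ d` ⇒
  `p ∈ H_{max(dn,2)}(g)`), the bound of (iii) on the LP value in the form
  `p_{min} − (1/d)Σ_{I₊}Aᵢᵢ` is `H_{max(dn,2)}`-certified (= (i)), and ★ **(iv)**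
  `exists_grid_eval_le` (some grid point `k/d` has `p(k/d) ≤ p(x) + (1/(4d)) Σ_{I₊} Aᵢᵢ` for all
  `x ∈ Q`; the proof works for every `d ≥ 1`).

## What is NOT formalised

The Bernstein-coefficient statements of (iii) (`p^{(d)}_{Ber}`, (1.22)–(1.24)); §3 (degree
`m ≥ 3`, Theorem 1.4 / 3.4 via Stirling numbers); the Schmüdgen-type bounds `p^{(r)}_{sch}` beyond
`H_r ⊆ T_r`; Proposition 2.2 / Corollary 2.3 / Proposition 2.4.
-/

noncomputable section

open MvPolynomial Finset

open scoped BigOperators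

namespace Literature.Algebra.Polynomial.HandelmanHypercubeQuadratic

variable {𝕜 : Type*} [Field 𝕜] [LinearOrder 𝕜] [IsStrictOrderedRing 𝕜]
variable {ι : Type*} [Fintype ι]

/-! ### §1 The truncated preprime `H_r(g)` of the hypercube ((1.9)) -/

/-- The Handelman products of the hypercube: `g^β = ∏ᵢ xᵢ^{β(inl i)} (1 − xᵢ)^{β(inr i)}`
(as in `Literature.Algebra.Polynomial.handelman_cube_degree`).
[cite: DeklerkLaurent2010, §1.1 eq. (1.5) and (1.9) (g^k = g₁^{k₁}⋯g_{2n}^{k_{2n}})] -/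
def cubeProd (β : ι ⊕ ι →₀ ℕ) : MvPolynomial ι 𝕜 :=
  (∏ i, X i ^ β (Sum.inl i)) * ∏ i, (1 - X i) ^ β (Sum.inr i)

/-- **The truncated preprime `H_r(g)`** of the hypercube `[0,1]ⁿ`: the cone of the
`λ · ∏ᵢ xᵢ^{aᵢ}(1 − xᵢ)^{bᵢ}` with `λ ≥ 0` and `|a| + |b| ≤ r`
(«`H_r(g) := {Σ_k λ_k g^k | deg(λ_k g^k) ≤ r, λ_k ∈ ℝ₊}`»), as the additive closure of its
generators; `IsHandelmanCube.exists_sum` / `isHandelmanCube_sum` identify it with the set of such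
finite sums. [cite: DeklerkLaurent2010, §1.1 eq. (1.9)] -/
inductive IsHandelmanCube (r : ℕ) : MvPolynomial ι 𝕜 → Prop
  | zero : IsHandelmanCube r 0
  | gen (β : ι ⊕ ι →₀ ℕ) (hβ : β.degree ≤ r) {a : 𝕜} (ha : 0 ≤ a) :
      IsHandelmanCube r (C a * cubeProd β)
  | add {p q : MvPolynomial ι 𝕜} :
      IsHandelmanCube r p → IsHandelmanCube r q → IsHandelmanCube r (p + q)

omit [LinearOrder 𝕜] [IsStrictOrderedRing 𝕜] in
/-- `g^β · g^γ = g^{β+γ}`. [folklore] -/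
private theorem cubeProd_mul (β γ : ι ⊕ ι →₀ ℕ) :
    (cubeProd β * cubeProd γ : MvPolynomial ι 𝕜) = cubeProd (β + γ) := by
  unfold cubeProd
  simp only [Finsupp.add_apply, pow_add, Finset.prod_mul_distrib]
  ring

omit [LinearOrder 𝕜] [IsStrictOrderedRing 𝕜] in
/-- `g^0 = 1`. [folklore] -/
private theorem cubeProd_zero : (cubeProd 0 : MvPolynomial ι 𝕜) = 1 := by
  simp [cubeProd]

omit [IsStrictOrderedRing 𝕜] in
/-- Finite sums of members. [cite: DeklerkLaurent2010, §1.1 eq. (1.9)] -/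
theorem IsHandelmanCube.sum {r : ℕ} {κ : Type*} (s : Finset κ) {f : κ → MvPolynomial ι 𝕜}
    (h : ∀ a ∈ s, IsHandelmanCube r (f a)) : IsHandelmanCube r (∑ a ∈ s, f a) := by
  classical
  induction s using Finset.induction_on with
  | empty => rw [Finset.sum_empty]; exact IsHandelmanCube.zero
  | insert a s ha ih =>
    rw [Finset.sum_insert ha]
    exact (h a (Finset.mem_insert_self a s)).add (ih fun b hb => h b (Finset.mem_insert_of_mem hb))

/-- Scaling by `λ ≥ 0`. [cite: DeklerkLaurent2010, §1.1 eq. (1.9)] -/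
theorem IsHandelmanCube.smul {r : ℕ} {p : MvPolynomial ι 𝕜} (h : IsHandelmanCube r p) {t : 𝕜}
    (ht : 0 ≤ t) : IsHandelmanCube r (C t * p) := by
  induction h with
  | zero => rw [mul_zero]; exact IsHandelmanCube.zero
  | @gen β hβ a ha =>
    rw [← mul_assoc, ← map_mul]
    exact IsHandelmanCube.gen β hβ (mul_nonneg ht ha)
  | add _ _ ih₁ ih₂ => rw [mul_add]; exact ih₁.add ih₂

omit [IsStrictOrderedRing 𝕜] in
/-- `H_r(g) ⊆ H_s(g)` for `r ≤ s`. [cite: DeklerkLaurent2010, §1.1 eq. (1.9)] -/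
theorem IsHandelmanCube.mono {r s : ℕ} {p : MvPolynomial ι 𝕜} (h : IsHandelmanCube r p)
    (hrs : r ≤ s) : IsHandelmanCube s p := by
  induction h with
  | zero => exact IsHandelmanCube.zero
  | @gen β hβ a ha => exact IsHandelmanCube.gen β (hβ.trans hrs) ha
  | add _ _ ih₁ ih₂ => exact ih₁.add ih₂

omit [IsStrictOrderedRing 𝕜] in
/-- `H_r(g) · g^γ ⊆ H_{r + |γ|}(g)`. [cite: DeklerkLaurent2010, §1.1 eq. (1.9)] -/
theorem IsHandelmanCube.mul_cubeProd {r : ℕ} {p : MvPolynomial ι 𝕜} (h : IsHandelmanCube r p)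
    (γ : ι ⊕ ι →₀ ℕ) : IsHandelmanCube (r + γ.degree) (p * cubeProd γ) := by
  induction h with
  | zero => rw [zero_mul]; exact IsHandelmanCube.zero
  | @gen β hβ a ha =>
    rw [mul_assoc, cubeProd_mul]
    exact IsHandelmanCube.gen (β + γ) (by rw [map_add]; omega) ha
  | add _ _ ih₁ ih₂ => rw [add_mul]; exact ih₁.add ih₂

/-- `H_r(g) · H_s(g) ⊆ H_{r+s}(g)`. [cite: DeklerkLaurent2010, §1.1 eq. (1.9)] -/
theorem IsHandelmanCube.mul {r s : ℕ} {p q : MvPolynomial ι 𝕜} (hp : IsHandelmanCube r p)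
    (hq : IsHandelmanCube s q) : IsHandelmanCube (r + s) (p * q) := by
  induction hq with
  | zero => rw [mul_zero]; exact IsHandelmanCube.zero
  | @gen β hβ a ha =>
    rw [mul_left_comm]
    exact ((hp.mul_cubeProd β).mono (by omega)).smul ha
  | add _ _ ih₁ ih₂ => rw [mul_add]; exact ih₁.add ih₂

omit [IsStrictOrderedRing 𝕜] in
/-- Nonnegative constants lie in every `H_r(g)`. [cite: DeklerkLaurent2010, §1.1 eq. (1.9)] -/
theorem isHandelmanCube_C {r : ℕ} {a : 𝕜} (ha : 0 ≤ a) :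
    IsHandelmanCube r (C a : MvPolynomial ι 𝕜) := by
  have h : IsHandelmanCube r (C a * cubeProd (0 : ι ⊕ ι →₀ ℕ) : MvPolynomial ι 𝕜) :=
    IsHandelmanCube.gen 0 (by simp) ha
  rwa [cubeProd_zero, mul_one] at h

/-- `xᵢ ∈ H_1(g)`. [cite: DeklerkLaurent2010, §1.1 eq. (1.5), (1.9)] -/
theorem isHandelmanCube_X (i : ι) : IsHandelmanCube 1 (X i : MvPolynomial ι 𝕜) := by
  have h := IsHandelmanCube.gen (𝕜 := 𝕜) (ι := ι) (r := 1) (Finsupp.single (Sum.inl i) 1)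
    (by simp) zero_le_one
  have hc : (cubeProd (Finsupp.single (Sum.inl i) 1) : MvPolynomial ι 𝕜) = X i := by
    classical
    simp [cubeProd, Finsupp.single_apply]
  rwa [hc, map_one, one_mul] at h

/-- `1 − xᵢ ∈ H_1(g)`. [cite: DeklerkLaurent2010, §1.1 eq. (1.5), (1.9)] -/
theorem isHandelmanCube_one_sub_X (i : ι) : IsHandelmanCube 1 (1 - X i : MvPolynomial ι 𝕜) := by
  have h := IsHandelmanCube.gen (𝕜 := 𝕜) (ι := ι) (r := 1) (Finsupp.single (Sum.inr i) 1)
    (by simp) zero_le_one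
  have hc : (cubeProd (Finsupp.single (Sum.inr i) 1) : MvPolynomial ι 𝕜) = 1 - X i := by
    classical
    simp [cubeProd, Finsupp.single_apply]
  rwa [hc, map_one, one_mul] at h

/-- `xᵢ (1 − xᵢ) ∈ H_2(g)`. [cite: DeklerkLaurent2010, §2, after (2.3) («q₁, q₂ ∈ H₂(g)»)] -/
theorem isHandelmanCube_X_mul_one_sub_X (i : ι) :
    IsHandelmanCube 2 (X i * (1 - X i) : MvPolynomial ι 𝕜) :=
  (isHandelmanCube_X i).mul (isHandelmanCube_one_sub_X i)

/-- `(1 − xᵢ)² + xᵢ ∈ H_2(g)`. [cite: DeklerkLaurent2010, §2, after (2.3) («q₁, q₂ ∈ H₂(g)»)] -/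
theorem isHandelmanCube_one_sub_X_sq_add_X (i : ι) :
    IsHandelmanCube 2 ((1 - X i) ^ 2 + X i : MvPolynomial ι 𝕜) := by
  rw [sq]
  exact ((isHandelmanCube_one_sub_X i).mul (isHandelmanCube_one_sub_X i)).add
    ((isHandelmanCube_X i).mono (by norm_num))

/-- **The explicit-sum description**: a member of `H_r(g)` is `Σ_{β ∈ s} λ_β g^β` with `λ_β ≥ 0`
and `|β| ≤ r`. [cite: DeklerkLaurent2010, §1.1 eq. (1.9)] -/
theorem IsHandelmanCube.exists_sum {r : ℕ} {p : MvPolynomial ι 𝕜} (h : IsHandelmanCube r p) :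
    ∃ (s : Finset (ι ⊕ ι →₀ ℕ)) (c : (ι ⊕ ι →₀ ℕ) → 𝕜), (∀ β ∈ s, 0 ≤ c β ∧ β.degree ≤ r) ∧
      p = ∑ β ∈ s, C (c β) * cubeProd β := by
  classical
  induction h with
  | zero => exact ⟨∅, fun _ => 0, fun _ h => (Finset.notMem_empty _ h).elim, by simp⟩
  | @gen β hβ a ha =>
    exact ⟨{β}, fun _ => a, fun γ hγ => ⟨ha, by rw [Finset.mem_singleton.1 hγ]; exact hβ⟩, by simp⟩
  | add _ _ ih₁ ih₂ =>
    obtain ⟨s₁, c₁, h₁, rfl⟩ := ih₁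
    obtain ⟨s₂, c₂, h₂, rfl⟩ := ih₂
    refine ⟨s₁ ∪ s₂, fun β => (if β ∈ s₁ then c₁ β else 0) + (if β ∈ s₂ then c₂ β else 0),
      fun β hβ => ⟨add_nonneg ?_ ?_, ?_⟩, ?_⟩
    · split_ifs with h
      · exact (h₁ β h).1
      · exact le_rfl
    · split_ifs with h
      · exact (h₂ β h).1
      · exact le_rfl
    · rcases Finset.mem_union.1 hβ with h | h
      · exact (h₁ β h).2
      · exact (h₂ β h).2
    · have e₁ : ∑ β ∈ s₁, C (c₁ β) * cubeProd β =
          ∑ β ∈ s₁ ∪ s₂, C (if β ∈ s₁ then c₁ β else 0) * (cubeProd β : MvPolynomial ι 𝕜) := by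
        have hs := Finset.sum_subset
          (f := fun β => C (if β ∈ s₁ then c₁ β else 0) * (cubeProd β : MvPolynomial ι 𝕜))
          (Finset.subset_union_left (s₂ := s₂)) (fun β _ hβ => by
            show C (if β ∈ s₁ then c₁ β else 0) * (cubeProd β : MvPolynomial ι 𝕜) = 0
            rw [if_neg hβ, map_zero, zero_mul])
        rw [← hs]
        exact Finset.sum_congr rfl fun β hβ => by rw [if_pos hβ]
      have e₂ : ∑ β ∈ s₂, C (c₂ β) * cubeProd β =
          ∑ β ∈ s₁ ∪ s₂, C (if β ∈ s₂ then c₂ β else 0) * (cubeProd β : MvPolynomial ι 𝕜) := by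
        have hs := Finset.sum_subset
          (f := fun β => C (if β ∈ s₂ then c₂ β else 0) * (cubeProd β : MvPolynomial ι 𝕜))
          (Finset.subset_union_right (s₁ := s₁)) (fun β _ hβ => by
            show C (if β ∈ s₂ then c₂ β else 0) * (cubeProd β : MvPolynomial ι 𝕜) = 0
            rw [if_neg hβ, map_zero, zero_mul])
        rw [← hs]
        exact Finset.sum_congr rfl fun β hβ => by rw [if_pos hβ]
      rw [e₁, e₂, ← Finset.sum_add_distrib]
      exact Finset.sum_congr rfl fun β _ => by rw [map_add, add_mul]

omit [IsStrictOrderedRing 𝕜] in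
/-- Conversely every such finite sum is a member. [cite: DeklerkLaurent2010, §1.1 eq. (1.9)] -/
theorem isHandelmanCube_sum {r : ℕ} (s : Finset (ι ⊕ ι →₀ ℕ)) (c : (ι ⊕ ι →₀ ℕ) → 𝕜)
    (h : ∀ β ∈ s, 0 ≤ c β ∧ β.degree ≤ r) :
    IsHandelmanCube r (∑ β ∈ s, C (c β) * cubeProd β) :=
  IsHandelmanCube.sum s fun β hβ => IsHandelmanCube.gen β (h β hβ).2 (h β hβ).1

/-- **Soundness**: members of `H_r(g)` are nonnegative on `Q = [0,1]ⁿ` (whence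
`p^{(r)}_{han,g} ≤ p_{min,Q}`, (1.13)). [cite: DeklerkLaurent2010, §1.1 eq. (1.13)] -/
theorem IsHandelmanCube.eval_nonneg {r : ℕ} {p : MvPolynomial ι 𝕜} (h : IsHandelmanCube r p)
    {x : ι → 𝕜} (hx0 : ∀ i, 0 ≤ x i) (hx1 : ∀ i, x i ≤ 1) : 0 ≤ eval x p := by
  induction h with
  | zero => simp
  | @gen β _ a ha =>
    rw [map_mul, eval_C]
    refine mul_nonneg ha ?_
    unfold cubeProd
    rw [map_mul, map_prod, map_prod]
    refine mul_nonneg (Finset.prod_nonneg fun i _ => ?_) (Finset.prod_nonneg fun i _ => ?_)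
    · rw [map_pow, eval_X]; exact pow_nonneg (hx0 i) _
    · rw [map_pow, map_sub, map_one, eval_X]; exact pow_nonneg (sub_nonneg.2 (hx1 i)) _
  | add _ _ ih₁ ih₂ => rw [map_add]; exact add_nonneg ih₁ ih₂

/-- (1.13) in certificate form: `p − t ∈ H_r(g)` ⇒ `t ≤ p` on `Q`.
[cite: DeklerkLaurent2010, §1.1 eq. (1.11), (1.13)] -/
theorem le_eval_of_isHandelmanCube_sub_C {r : ℕ} {p : MvPolynomial ι 𝕜} {t : 𝕜}
    (h : IsHandelmanCube r (p - C t)) {x : ι → 𝕜} (hx0 : ∀ i, 0 ≤ x i) (hx1 : ∀ i, x i ≤ 1) :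
    t ≤ eval x p := by
  have := h.eval_nonneg hx0 hx1
  rw [map_sub, eval_C] at this
  linarith

/-! ### §2 The Bernstein operator on the hypercube (§1.3) -/

variable [DecidableEq ι]

/-- The univariate Bernstein basis polynomial in the variable `xᵢ`:
`p_{d,m}(xᵢ) = C(d,m) xᵢ^m (1 − xᵢ)^{d−m}` (Mathlib's `bernsteinPolynomial`, substituted at `xᵢ`).
[cite: DeklerkLaurent2010, §1.3 eq. (1.16)] -/
def bern (i : ι) (d m : ℕ) : MvPolynomial ι 𝕜 :=
  Polynomial.aeval (X i : MvPolynomial ι 𝕜) (bernsteinPolynomial 𝕜 d m)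

omit [LinearOrder 𝕜] [IsStrictOrderedRing 𝕜] [Fintype ι] [DecidableEq ι] in
/-- `p_{d,m}(xᵢ) = C(d,m) xᵢ^m (1 − xᵢ)^{d−m}`. [cite: DeklerkLaurent2010, §1.3 eq. (1.16)] -/
theorem bern_eq (i : ι) (d m : ℕ) :
    (bern i d m : MvPolynomial ι 𝕜) = C (d.choose m : 𝕜) * X i ^ m * (1 - X i) ^ (d - m) := by
  unfold bern bernsteinPolynomial
  simp [map_natCast]

/-- The multivariate Bernstein polynomial `P_{d,k} = ∏ᵢ p_{d,kᵢ}(xᵢ)`, `k ∈ [d]₀ⁿ`.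
[cite: DeklerkLaurent2010, §1.3 eq. (1.19)] -/
def bernBox (d : ℕ) (k : ι → Fin (d + 1)) : MvPolynomial ι 𝕜 := ∏ i, bern i d (k i)

variable (𝕜) in
/-- The grid point `k/d ∈ Q(d)`. [cite: DeklerkLaurent2010, §1.1 eq. (1.14)] -/
def gridPt (d : ℕ) (k : ι → Fin (d + 1)) : ι → 𝕜 := fun i => ((k i : ℕ) : 𝕜) / (d : 𝕜)

omit [Fintype ι] [DecidableEq ι] in
/-- Grid points lie in `Q`. [cite: DeklerkLaurent2010, §1.1 eq. (1.14)] -/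
theorem gridPt_mem {d : ℕ} (k : ι → Fin (d + 1)) (i : ι) :
    0 ≤ gridPt 𝕜 d k i ∧ gridPt 𝕜 d k i ≤ 1 := by
  unfold gridPt
  refine ⟨div_nonneg (Nat.cast_nonneg _) (Nat.cast_nonneg _), ?_⟩
  rcases Nat.eq_zero_or_pos d with hd | hd
  · subst hd; simp
  · rw [div_le_one (by exact_mod_cast hd)]
    exact_mod_cast Nat.lt_succ_iff.1 (k i).isLt

/-- **The Bernstein approximation of order `d`** of (the function of) a polynomial `p` on `Q`:
`B_d(p) := Σ_{k ∈ [d]₀ⁿ} p(k/d) P_{d,k}`. [cite: DeklerkLaurent2010, §1.3 (definition of B_d(f))] -/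
def bernsteinOp (d : ℕ) (p : MvPolynomial ι 𝕜) : MvPolynomial ι 𝕜 :=
  ∑ k : ι → Fin (d + 1), C (eval (gridPt 𝕜 d k) p) * bernBox d k

omit [LinearOrder 𝕜] [IsStrictOrderedRing 𝕜] [Fintype ι] [DecidableEq ι] in
/-- `Σ_m p_{d,m}(xᵢ) = 1`. [cite: DeklerkLaurent2010, §1.3 eq. (1.20)] -/
theorem sum_bern (i : ι) (d : ℕ) : ∑ m : Fin (d + 1), (bern i d m : MvPolynomial ι 𝕜) = 1 := by
  rw [Fin.sum_univ_eq_sum_range (fun m => (bern i d m : MvPolynomial ι 𝕜)) (d + 1)]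
  unfold bern
  rw [← map_sum, bernsteinPolynomial.sum, map_one]

omit [LinearOrder 𝕜] [IsStrictOrderedRing 𝕜] [Fintype ι] [DecidableEq ι] in
/-- `Σ_m m · p_{d,m}(xᵢ) = d xᵢ` (Mathlib's `bernsteinPolynomial.sum_smul`, at `xᵢ`). [folklore] -/
private theorem sum_natCast_mul_bern [CharZero 𝕜] (i : ι) (d : ℕ) :
    ∑ m ∈ Finset.range (d + 1), C ((m : ℕ) : 𝕜) * (bern i d m : MvPolynomial ι 𝕜) =
      C (d : 𝕜) * X i := by
  have h := congrArg (Polynomial.aeval (X i : MvPolynomial ι 𝕜)) (bernsteinPolynomial.sum_smul 𝕜 d)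
  simp only [map_sum, nsmul_eq_mul, map_mul, map_natCast, Polynomial.aeval_X] at h
  unfold bern
  simp only [map_natCast]
  exact h

omit [LinearOrder 𝕜] [IsStrictOrderedRing 𝕜] [Fintype ι] [DecidableEq ι] in
/-- `Σ_m m(m−1) · p_{d,m}(xᵢ) = d(d−1) xᵢ²` (Mathlib's `bernsteinPolynomial.sum_mul_smul`, at `xᵢ`).
[folklore] -/
private theorem sum_natCast_desc_mul_bern [CharZero 𝕜] (i : ι) (d : ℕ) :
    ∑ m ∈ Finset.range (d + 1), C (((m * (m - 1) : ℕ) : 𝕜)) * (bern i d m : MvPolynomial ι 𝕜) =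
      C (((d * (d - 1) : ℕ) : 𝕜)) * X i ^ 2 := by
  have h := congrArg (Polynomial.aeval (X i : MvPolynomial ι 𝕜))
    (bernsteinPolynomial.sum_mul_smul 𝕜 d)
  simp only [map_sum, nsmul_eq_mul, map_mul, map_natCast, map_pow, Polynomial.aeval_X] at h
  unfold bern
  simp only [map_natCast]
  exact h

omit [LinearOrder 𝕜] [IsStrictOrderedRing 𝕜] [Fintype ι] [DecidableEq ι] in
/-- First moment: `Σ_m (m/d) p_{d,m}(xᵢ) = xᵢ` («`B_d(x) = x`»).
[cite: DeklerkLaurent2010, §1.3 («B_d(1) = 1 and B_d(x) = x»)] -/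
theorem sum_div_mul_bern [CharZero 𝕜] (i : ι) {d : ℕ} (hd : 0 < d) :
    ∑ m : Fin (d + 1), C (((m : ℕ) : 𝕜) / d) * (bern i d m : MvPolynomial ι 𝕜) = X i := by
  have hdne : (d : 𝕜) ≠ 0 := by exact_mod_cast hd.ne'
  rw [Fin.sum_univ_eq_sum_range (fun m => C (((m : ℕ) : 𝕜) / d) * (bern i d m : MvPolynomial ι 𝕜))
    (d + 1)]
  have h2 : ∑ m ∈ Finset.range (d + 1), C (((m : ℕ) : 𝕜) / d) * (bern i d m : MvPolynomial ι 𝕜) =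
      C (d : 𝕜)⁻¹ * ∑ m ∈ Finset.range (d + 1), C ((m : ℕ) : 𝕜) * bern i d m := by
    rw [Finset.mul_sum]
    refine Finset.sum_congr rfl fun m _ => ?_
    rw [← mul_assoc, ← map_mul, div_eq_inv_mul]
  rw [h2, sum_natCast_mul_bern, ← mul_assoc, ← map_mul, inv_mul_cancel₀ hdne, map_one, one_mul]

omit [LinearOrder 𝕜] [IsStrictOrderedRing 𝕜] [Fintype ι] [DecidableEq ι] in
/-- Second moment, **(1.17)**: `Σ_m (m/d)² p_{d,m}(xᵢ) = xᵢ² + (1/d) xᵢ(1 − xᵢ)`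
(«`B_d(x²) = x² + (1/d) x(1 − x)`»). [cite: DeklerkLaurent2010, §1.3 eq. (1.17)] -/
theorem sum_div_sq_mul_bern [CharZero 𝕜] (i : ι) {d : ℕ} (hd : 0 < d) :
    ∑ m : Fin (d + 1), C ((((m : ℕ) : 𝕜) / d) ^ 2) * (bern i d m : MvPolynomial ι 𝕜) =
      X i ^ 2 + C (1 / (d : 𝕜)) * (X i * (1 - X i)) := by
  have hdne : (d : 𝕜) ≠ 0 := by exact_mod_cast hd.ne'
  -- `m² = m(m−1) + m`
  have hsq : ∀ m : ℕ, (((m : ℕ) : 𝕜)) ^ 2 = ((m * (m - 1) : ℕ) : 𝕜) + (m : 𝕜) := by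
    intro m
    rcases m with _ | m
    · simp
    · push_cast [Nat.succ_sub_one]; ring
  have h3 : ∑ m ∈ Finset.range (d + 1), C (((m : ℕ) : 𝕜) ^ 2) * (bern i d m : MvPolynomial ι 𝕜) =
      C (((d * (d - 1) : ℕ) : 𝕜)) * X i ^ 2 + C (d : 𝕜) * X i := by
    rw [← sum_natCast_mul_bern, ← sum_natCast_desc_mul_bern, ← Finset.sum_add_distrib]
    exact Finset.sum_congr rfl fun m _ => by rw [hsq, map_add, add_mul]
  rw [Fin.sum_univ_eq_sum_range
    (fun m => C ((((m : ℕ) : 𝕜) / d) ^ 2) * (bern i d m : MvPolynomial ι 𝕜)) (d + 1)]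
  have h4 : ∑ m ∈ Finset.range (d + 1), C ((((m : ℕ) : 𝕜) / d) ^ 2) * (bern i d m : MvPolynomial ι 𝕜) =
      C ((d : 𝕜)⁻¹ ^ 2) * ∑ m ∈ Finset.range (d + 1), C (((m : ℕ) : 𝕜) ^ 2) * bern i d m := by
    rw [Finset.mul_sum]
    refine Finset.sum_congr rfl fun m _ => ?_
    rw [← mul_assoc, ← map_mul, div_eq_mul_inv, mul_pow, mul_comm ((d : 𝕜)⁻¹ ^ 2)]
  rw [h4, h3]
  have hcast : ((d * (d - 1) : ℕ) : 𝕜) = (d : 𝕜) * ((d : 𝕜) - 1) := by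
    rw [Nat.cast_mul, Nat.cast_pred hd]
  rw [hcast]
  have e1 : C ((d : 𝕜)⁻¹ ^ 2) * (C ((d : 𝕜) * ((d : 𝕜) - 1)) * X i ^ 2 + C (d : 𝕜) * X i) =
      C ((d : 𝕜)⁻¹ ^ 2 * ((d : 𝕜) * ((d : 𝕜) - 1))) * X i ^ 2 +
        C ((d : 𝕜)⁻¹ ^ 2 * (d : 𝕜)) * (X i : MvPolynomial ι 𝕜) := by
    simp only [map_mul]
    ring
  have e2 : (d : 𝕜)⁻¹ ^ 2 * ((d : 𝕜) * ((d : 𝕜) - 1)) = 1 - 1 / (d : 𝕜) := by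
    rw [sq, one_div, show (d : 𝕜)⁻¹ * (d : 𝕜)⁻¹ * ((d : 𝕜) * ((d : 𝕜) - 1)) =
      ((d : 𝕜)⁻¹ * (d : 𝕜)) * ((d : 𝕜)⁻¹ * (d : 𝕜)) - (d : 𝕜)⁻¹ * ((d : 𝕜)⁻¹ * (d : 𝕜)) by ring,
      inv_mul_cancel₀ hdne]
    ring
  have e3 : (d : 𝕜)⁻¹ ^ 2 * (d : 𝕜) = 1 / (d : 𝕜) := by
    rw [sq, one_div, mul_assoc, inv_mul_cancel₀ hdne, mul_one]
  rw [e1, e2, e3, map_sub, map_one]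
  ring

omit [LinearOrder 𝕜] [IsStrictOrderedRing 𝕜] in
/-- **Multiplicativity on products of univariate functions**: if `p(x) = ∏ᵢ φᵢ(xᵢ)` as functions,
then `B_d(p) = ∏ᵢ (Σ_m φᵢ(m/d) p_{d,m}(xᵢ))` («the Bernstein operator is multiplicative when
applying it to functions that are products of functions in disjoint sets of variables»).
[cite: DeklerkLaurent2010, §1.3 (multiplicativity; B_d(x^k) = ∏ B_d(xᵢ^{kᵢ}))] -/
theorem bernsteinOp_eq_prod_of_eval (d : ℕ) (p : MvPolynomial ι 𝕜) (φ : ι → 𝕜 → 𝕜)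
    (hp : ∀ x : ι → 𝕜, eval x p = ∏ i, φ i (x i)) :
    bernsteinOp d p = ∏ i, ∑ m : Fin (d + 1), C (φ i (((m : ℕ) : 𝕜) / d)) * bern i d m := by
  classical
  unfold bernsteinOp bernBox
  rw [Finset.prod_univ_sum, Fintype.piFinset_univ]
  refine Finset.sum_congr rfl fun k _ => ?_
  rw [hp, map_prod, ← Finset.prod_mul_distrib]
  rfl

omit [LinearOrder 𝕜] [IsStrictOrderedRing 𝕜] in
/-- **(1.20)** `Σ_k P_{d,k} = 1`, i.e. `B_d(1) = 1`. [cite: DeklerkLaurent2010, §1.3 eq. (1.20)] -/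
theorem bernsteinOp_one (d : ℕ) : bernsteinOp d (1 : MvPolynomial ι 𝕜) = 1 := by
  rw [bernsteinOp_eq_prod_of_eval d 1 (fun _ _ => 1) (fun x => by simp)]
  simp only [map_one, one_mul, sum_bern, Finset.prod_const_one]

omit [LinearOrder 𝕜] [IsStrictOrderedRing 𝕜] in
/-- Linearity: `B_d(p + q) = B_d(p) + B_d(q)`. [cite: DeklerkLaurent2010, §1.3 («B_d is a linear operator»)] -/
theorem bernsteinOp_add (d : ℕ) (p q : MvPolynomial ι 𝕜) :
    bernsteinOp d (p + q) = bernsteinOp d p + bernsteinOp d q := by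
  unfold bernsteinOp
  rw [← Finset.sum_add_distrib]
  exact Finset.sum_congr rfl fun k _ => by rw [map_add, map_add, add_mul]

omit [LinearOrder 𝕜] [IsStrictOrderedRing 𝕜] in
/-- Linearity: `B_d(p − q) = B_d(p) − B_d(q)`. [cite: DeklerkLaurent2010, §1.3 («B_d is a linear operator»)] -/
theorem bernsteinOp_sub (d : ℕ) (p q : MvPolynomial ι 𝕜) :
    bernsteinOp d (p - q) = bernsteinOp d p - bernsteinOp d q := by
  unfold bernsteinOp
  rw [← Finset.sum_sub_distrib]
  exact Finset.sum_congr rfl fun k _ => by rw [map_sub, map_sub, sub_mul]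

omit [LinearOrder 𝕜] [IsStrictOrderedRing 𝕜] in
/-- Linearity: `B_d(a p) = a B_d(p)`. [cite: DeklerkLaurent2010, §1.3 («B_d is a linear operator»)] -/
theorem bernsteinOp_C_mul (d : ℕ) (a : 𝕜) (p : MvPolynomial ι 𝕜) :
    bernsteinOp d (C a * p) = C a * bernsteinOp d p := by
  unfold bernsteinOp
  rw [Finset.mul_sum]
  exact Finset.sum_congr rfl fun k _ => by rw [map_mul, eval_C, map_mul, mul_assoc]

omit [LinearOrder 𝕜] [IsStrictOrderedRing 𝕜] in
/-- Linearity over finite sums. [cite: DeklerkLaurent2010, §1.3 («B_d is a linear operator»)] -/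
theorem bernsteinOp_sum (d : ℕ) {κ : Type*} (s : Finset κ) (f : κ → MvPolynomial ι 𝕜) :
    bernsteinOp d (∑ a ∈ s, f a) = ∑ a ∈ s, bernsteinOp d (f a) := by
  classical
  induction s using Finset.induction_on with
  | empty =>
    rw [Finset.sum_empty, Finset.sum_empty]
    unfold bernsteinOp
    simp
  | insert a s ha ih => rw [Finset.sum_insert ha, Finset.sum_insert ha, bernsteinOp_add, ih]

omit [LinearOrder 𝕜] [IsStrictOrderedRing 𝕜] in
/-- `B_d(c) = c`. [cite: DeklerkLaurent2010, §1.3 eq. (1.20)] -/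
theorem bernsteinOp_C (d : ℕ) (a : 𝕜) : bernsteinOp d (C a : MvPolynomial ι 𝕜) = C a := by
  rw [← mul_one (C a), bernsteinOp_C_mul, bernsteinOp_one]

omit [LinearOrder 𝕜] [IsStrictOrderedRing 𝕜] in
/-- `B_d(xᵢ) = xᵢ` («`B_d` preserves linear polynomials»). [cite: DeklerkLaurent2010, §1.3] -/
theorem bernsteinOp_X [CharZero 𝕜] {d : ℕ} (hd : 0 < d) (i : ι) :
    bernsteinOp d (X i : MvPolynomial ι 𝕜) = X i := by
  classical
  rw [bernsteinOp_eq_prod_of_eval d (X i) (fun l t => if l = i then t else 1) (fun x => by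
    rw [eval_X, Fintype.prod_ite_eq'])]
  have hl : ∀ l, ∑ m : Fin (d + 1), C ((fun l t => if l = i then t else (1 : 𝕜)) l (((m : ℕ) : 𝕜) / d)) *
      (bern l d m : MvPolynomial ι 𝕜) = if l = i then X l else 1 := by
    intro l
    by_cases h : l = i
    · simp only [h, if_true]; exact sum_div_mul_bern i hd
    · simp only [h, if_false, map_one, one_mul]; exact sum_bern l d
  rw [Finset.prod_congr rfl fun l _ => hl l, Fintype.prod_ite_eq']

omit [LinearOrder 𝕜] [IsStrictOrderedRing 𝕜] [Fintype ι] [DecidableEq ι] in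
/-- The moments of order `≤ 2` in one line: `Σ_m (m/d)^n p_{d,m}(xᵢ)` is `1`, `xᵢ`,
`xᵢ² + (1/d)xᵢ(1−xᵢ)` for `n = 0, 1, 2`. [cite: DeklerkLaurent2010, §1.3 eq. (1.17)] -/
theorem sum_div_pow_mul_bern [CharZero 𝕜] (i : ι) {d : ℕ} (hd : 0 < d) {n : ℕ} (hn : n ≤ 2) :
    ∑ m : Fin (d + 1), C ((((m : ℕ) : 𝕜) / d) ^ n) * (bern i d m : MvPolynomial ι 𝕜) =
      if n = 2 then X i ^ 2 + C (1 / (d : 𝕜)) * (X i * (1 - X i)) else X i ^ n := by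
  interval_cases n
  · simp only [pow_zero, map_one, one_mul, sum_bern]; simp
  · simp only [pow_one, sum_div_mul_bern i hd]; simp
  · simp only [sum_div_sq_mul_bern i hd, if_true]

omit [LinearOrder 𝕜] [IsStrictOrderedRing 𝕜] in
/-- `B_d(xᵢ²) = xᵢ² + (1/d) xᵢ(1 − xᵢ)` and `B_d(xᵢ xⱼ) = xᵢ xⱼ` for `i ≠ j`.
[cite: DeklerkLaurent2010, §1.3 eq. (1.17) and («B_d(x^k) = x^k for k ∈ {0,1}ⁿ»)] -/
theorem bernsteinOp_X_mul_X [CharZero 𝕜] {d : ℕ} (hd : 0 < d) (i j : ι) :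
    bernsteinOp d (X i * X j : MvPolynomial ι 𝕜) =
      X i * X j + if i = j then C (1 / (d : 𝕜)) * (X i * (1 - X i)) else 0 := by
  -- `xᵢ xⱼ = ∏_l x_l^{n_l}`, `n_l = [l = i] + [l = j] ≤ 2`
  set n : ι → ℕ := fun l => (if l = i then 1 else 0) + (if l = j then 1 else 0) with hn
  have hn2 : ∀ l, n l ≤ 2 := fun l => by simp only [hn]; split_ifs <;> omega
  have hpow : ∀ y : ι → 𝕜, ∏ l, y l ^ n l = y i * y j := by
    intro y
    simp only [hn, pow_add, Finset.prod_mul_distrib, pow_boole, Fintype.prod_ite_eq']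
  have hpowX : ∏ l, (X l : MvPolynomial ι 𝕜) ^ n l = X i * X j := by
    simp only [hn, pow_add, Finset.prod_mul_distrib, pow_boole, Fintype.prod_ite_eq']
  rw [bernsteinOp_eq_prod_of_eval d (X i * X j) (fun l t => t ^ n l) (fun x => by
    rw [map_mul, eval_X, eval_X, hpow])]
  rw [Finset.prod_congr rfl fun l _ => sum_div_pow_mul_bern l hd (hn2 l)]
  by_cases hij : i = j
  · subst hij
    rw [if_pos rfl]
    have hl : ∀ l, (if n l = 2 then X l ^ 2 + C (1 / (d : 𝕜)) * (X l * (1 - X l)) else X l ^ n l) =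
        if l = i then X l ^ 2 + C (1 / (d : 𝕜)) * (X l * (1 - X l)) else (1 : MvPolynomial ι 𝕜) := by
      intro l
      by_cases h : l = i
      · have : n l = 2 := by simp only [hn, if_pos h]
        rw [if_pos this, if_pos h]
      · have : n l = 0 := by simp only [hn, if_neg h]
        rw [this, if_neg (by norm_num), if_neg h, pow_zero]
    rw [Finset.prod_congr rfl fun l _ => hl l, Fintype.prod_ite_eq', sq]
  · rw [if_neg hij, add_zero]
    have hl : ∀ l, (if n l = 2 then X l ^ 2 + C (1 / (d : 𝕜)) * (X l * (1 - X l)) else X l ^ n l) =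
        (X l : MvPolynomial ι 𝕜) ^ n l := by
      intro l
      have : n l ≠ 2 := by
        simp only [hn]
        split_ifs with h1 h2
        · exact absurd (h1.symm.trans h2) hij
        all_goals omega
      rw [if_neg this]
    rw [Finset.prod_congr rfl fun l _ => hl l]
    exact hpowX

/-- The exponent `β(k) = (k, d − k)` of `P_{d,k}` as a Handelman product, of degree `dn`.
[cite: DeklerkLaurent2010, §1.3 («each P_{d,k} belongs to the set H_{dn}(g)»)] -/
def boxExp (d : ℕ) (k : ι → Fin (d + 1)) : ι ⊕ ι →₀ ℕ :=
  Finsupp.equivFunOnFinite.symm (Sum.elim (fun i => (k i : ℕ)) fun i => d - (k i : ℕ))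

omit [LinearOrder 𝕜] [IsStrictOrderedRing 𝕜] [DecidableEq ι] in
/-- `P_{d,k} = (∏ C(d,kᵢ)) · g^{β(k)}`. [cite: DeklerkLaurent2010, §1.3 eq. (1.19)] -/
theorem bernBox_eq (d : ℕ) (k : ι → Fin (d + 1)) :
    (bernBox d k : MvPolynomial ι 𝕜) = C (∏ i, (d.choose (k i) : 𝕜)) * cubeProd (boxExp d k) := by
  unfold bernBox cubeProd boxExp
  simp only [bern_eq, Finsupp.coe_equivFunOnFinite_symm, Sum.elim_inl, Sum.elim_inr, map_prod]
  rw [Finset.prod_mul_distrib, Finset.prod_mul_distrib, mul_assoc]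

omit [DecidableEq ι] in
/-- `|β(k)| = d n`. [cite: DeklerkLaurent2010, §1.3 («each P_{d,k} belongs to the set H_{dn}(g)»)] -/
theorem degree_boxExp (d : ℕ) (k : ι → Fin (d + 1)) :
    (boxExp d k).degree = d * Fintype.card ι := by
  rw [Finsupp.degree_eq_sum, Fintype.sum_sum_type]
  simp only [boxExp, Finsupp.coe_equivFunOnFinite_symm, Sum.elim_inl, Sum.elim_inr]
  rw [← Finset.sum_add_distrib, Finset.sum_congr rfl fun i _ =>
    Nat.add_sub_cancel' (Nat.lt_succ_iff.1 (k i).isLt), Finset.sum_const, Finset.card_univ,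
    smul_eq_mul, mul_comm]

/-- **`B_d(p) ∈ H_{dn}(g)` when `p ≥ 0` on the grid `Q(d)`** (its Bernstein-basis coefficients
`p(k/d)` are then `≥ 0` and «each `P_{d,k}` belongs to `H_{dn}(g)`»).
[cite: DeklerkLaurent2010, §1.3 eq. (1.23)–(1.24); §2, after (2.3) («B_d(p − p_min,Q) ∈ H_{dn}(g)»)] -/
theorem isHandelmanCube_bernsteinOp {d : ℕ} {p : MvPolynomial ι 𝕜}
    (hp : ∀ k : ι → Fin (d + 1), 0 ≤ eval (gridPt 𝕜 d k) p) :
    IsHandelmanCube (d * Fintype.card ι) (bernsteinOp d p) := by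
  unfold bernsteinOp
  refine IsHandelmanCube.sum _ fun k _ => ?_
  rw [bernBox_eq, ← mul_assoc, ← map_mul]
  exact IsHandelmanCube.gen _ (degree_boxExp d k).le
    (mul_nonneg (hp k) (Finset.prod_nonneg fun i _ => Nat.cast_nonneg _))

/-- **`B_d(p) ≥ p_{min,Q(d)}` on `Q`**: a lower bound of `p` on the grid `Q(d)` bounds `B_d(p)`
from below on `Q` (the `P_{d,k}` are `≥ 0` on `Q` and sum to `1`).
[cite: DeklerkLaurent2010, §2, proof of Theorem 2.1 (iv) («B_d(p) ≥ p_min,Q(d)»)] -/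
theorem le_eval_bernsteinOp {d : ℕ} {p : MvPolynomial ι 𝕜} {μ : 𝕜}
    (hp : ∀ k : ι → Fin (d + 1), μ ≤ eval (gridPt 𝕜 d k) p) {x : ι → 𝕜} (hx0 : ∀ i, 0 ≤ x i)
    (hx1 : ∀ i, x i ≤ 1) : μ ≤ eval x (bernsteinOp d p) := by
  have hP : ∀ k : ι → Fin (d + 1), 0 ≤ eval x (bernBox d k : MvPolynomial ι 𝕜) := by
    intro k
    rw [bernBox_eq, map_mul, eval_C]
    refine mul_nonneg (Finset.prod_nonneg fun i _ => Nat.cast_nonneg _) ?_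
    have h := (IsHandelmanCube.gen (𝕜 := 𝕜) (r := d * Fintype.card ι) (boxExp d k)
      (degree_boxExp d k).le zero_le_one).eval_nonneg hx0 hx1
    rwa [map_mul, eval_C, one_mul] at h
  have h1 : eval x (∑ k : ι → Fin (d + 1), (bernBox d k : MvPolynomial ι 𝕜)) = 1 := by
    have := bernsteinOp_one (𝕜 := 𝕜) (ι := ι) d
    unfold bernsteinOp at this
    simp only [map_one, one_mul] at this
    rw [this, map_one]
  unfold bernsteinOp
  rw [map_sum]
  calc μ = μ * eval x (∑ k : ι → Fin (d + 1), (bernBox d k : MvPolynomial ι 𝕜)) := by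
        rw [h1, mul_one]
    _ = ∑ k : ι → Fin (d + 1), μ * eval x (bernBox d k : MvPolynomial ι 𝕜) := by
        rw [map_sum, Finset.mul_sum]
    _ ≤ ∑ k : ι → Fin (d + 1), eval x (C (eval (gridPt 𝕜 d k) p) * bernBox d k) :=
        Finset.sum_le_sum fun k _ => by
          rw [map_mul, eval_C]; exact mul_le_mul_of_nonneg_right (hp k) (hP k)

/-! ### §3 Quadratic polynomials: (2.2), (2.3) and Theorem 2.1 -/

/-- `p = xᵀ A x + bᵀ x + c`. [cite: DeklerkLaurent2010, §2 (p = xᵀAx + bᵀx + c)] -/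
def quadPoly (A : Matrix ι ι 𝕜) (b : ι → 𝕜) (c : 𝕜) : MvPolynomial ι 𝕜 :=
  ∑ i, ∑ j, C (A i j) * (X i * X j) + ∑ i, C (b i) * X i + C c

/-- `Σ_{i ∈ I₊} Aᵢᵢ` (`I₊ = {i | Aᵢᵢ > 0}`), written as `Σᵢ max(Aᵢᵢ, 0)`; `C(d,p) = (1/d) Σ_{I₊} Aᵢᵢ`.
[cite: DeklerkLaurent2010, §2 eq. (2.1), (2.3)] -/
def posDiagSum (A : Matrix ι ι 𝕜) : 𝕜 := ∑ i, max (A i i) 0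

omit [DecidableEq ι] in
/-- `Σ_{I₊} Aᵢᵢ ≥ 0`. [cite: DeklerkLaurent2010, §2 eq. (2.1)] -/
theorem posDiagSum_nonneg (A : Matrix ι ι 𝕜) : 0 ≤ posDiagSum A :=
  Finset.sum_nonneg fun _ _ => le_max_right _ _

omit [LinearOrder 𝕜] [IsStrictOrderedRing 𝕜] [DecidableEq ι] in
/-- Evaluation of `quadPoly`. [cite: DeklerkLaurent2010, §2] -/
theorem eval_quadPoly (A : Matrix ι ι 𝕜) (b : ι → 𝕜) (c : 𝕜) (x : ι → 𝕜) :
    eval x (quadPoly A b c) = ∑ i, ∑ j, A i j * (x i * x j) + ∑ i, b i * x i + c := by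
  simp [quadPoly, map_sum]

/-- **(2.2)** `B_d(p) = p + (1/d) Σᵢ Aᵢᵢ xᵢ(1 − xᵢ)` for `p = xᵀAx + bᵀx + c`, `d ≥ 1`.
[cite: DeklerkLaurent2010, §2 eq. (2.2)] -/
theorem bernsteinOp_quadPoly {d : ℕ} (hd : 0 < d) (A : Matrix ι ι 𝕜) (b : ι → 𝕜)
    (c : 𝕜) :
    bernsteinOp d (quadPoly A b c) =
      quadPoly A b c + C (1 / (d : 𝕜)) * ∑ i, C (A i i) * (X i * (1 - X i)) := by
  unfold quadPoly
  rw [bernsteinOp_add, bernsteinOp_add, bernsteinOp_C, bernsteinOp_sum, bernsteinOp_sum]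
  simp only [bernsteinOp_sum, bernsteinOp_C_mul, bernsteinOp_X hd, bernsteinOp_X_mul_X hd,
    mul_add, Finset.sum_add_distrib, mul_ite, mul_zero, Finset.sum_ite_eq, Finset.mem_univ,
    if_true]
  rw [Finset.mul_sum]
  have : ∑ i, C (A i i) * (C (1 / (d : 𝕜)) * (X i * (1 - X i))) =
      ∑ i, C (1 / (d : 𝕜)) * (C (A i i) * (X i * (1 - X i)) : MvPolynomial ι 𝕜) :=
    Finset.sum_congr rfl fun i _ => by ring
  rw [this]
  ring

/-- **The identity (2.3)**: for `p = xᵀAx + bᵀx + c`, `d ≥ 1` and any constant `λ`,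
`p − λ = B_d(p − λ) + q₁ + q₂ − C(d,p)` with `q₁ = (1/d) Σ_{I₋} |Aᵢᵢ| xᵢ(1−xᵢ)`,
`q₂ = (1/d) Σ_{I₊} Aᵢᵢ ((1 − xᵢ)² + xᵢ)`, `C(d,p) = (1/d) Σ_{I₊} Aᵢᵢ` (here `|Aᵢᵢ|` on `I₋` is
`max(−Aᵢᵢ, 0)` and `Aᵢᵢ` on `I₊` is `max(Aᵢᵢ, 0)`; «we used the identity
`−xᵢ(1 − xᵢ) = (xᵢ − 1)² + xᵢ − 1`»). [cite: DeklerkLaurent2010, §2 eq. (2.3)] -/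
theorem quadPoly_sub_C_eq {d : ℕ} (hd : 0 < d) (A : Matrix ι ι 𝕜) (b : ι → 𝕜)
    (c lam : 𝕜) :
    quadPoly A b c - C lam =
      bernsteinOp d (quadPoly A b c - C lam) +
        C (1 / (d : 𝕜)) * ∑ i, C (max (-A i i) 0) * (X i * (1 - X i)) +
        C (1 / (d : 𝕜)) * ∑ i, C (max (A i i) 0) * ((1 - X i) ^ 2 + X i) -
        C (posDiagSum A / d) := by
  rw [bernsteinOp_sub, bernsteinOp_C, bernsteinOp_quadPoly hd]
  unfold posDiagSum
  have key : ∀ i : ι, C (A i i) * (X i * (1 - X i)) + C (max (-A i i) 0) * (X i * (1 - X i)) +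
      C (max (A i i) 0) * ((1 - X i) ^ 2 + X i) - C (max (A i i) 0) = (0 : MvPolynomial ι 𝕜) := by
    intro i
    have hmax : max (-A i i) 0 = max (A i i) 0 - A i i := by
      rcases le_total (A i i) 0 with h | h
      · rw [max_eq_left (neg_nonneg.2 h), max_eq_right h]; ring
      · rw [max_eq_right (neg_nonpos.2 h), max_eq_left h]; ring
    rw [hmax, map_sub]
    ring
  have hC : C ((∑ i, max (A i i) 0) / (d : 𝕜)) =
      C (1 / (d : 𝕜)) * ∑ i, (C (max (A i i) 0) : MvPolynomial ι 𝕜) := by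
    rw [← map_sum, ← map_mul, one_div, inv_mul_eq_div]
  have hsum : C (1 / (d : 𝕜)) * ∑ i, C (A i i) * (X i * (1 - X i)) +
      C (1 / (d : 𝕜)) * ∑ i, C (max (-A i i) 0) * (X i * (1 - X i)) +
      C (1 / (d : 𝕜)) * ∑ i, C (max (A i i) 0) * ((1 - X i) ^ 2 + X i) -
      C ((∑ i, max (A i i) 0) / d) = (0 : MvPolynomial ι 𝕜) := by
    rw [hC, ← mul_add, ← mul_add, ← mul_sub, ← Finset.sum_add_distrib, ← Finset.sum_add_distrib,
      ← Finset.sum_sub_distrib, Finset.sum_congr rfl fun i _ => key i, Finset.sum_const_zero,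
      mul_zero]
  linear_combination -hsum

/-- **Theorem 2.1 (i).**  For `p = xᵀAx + bᵀx + c`, `d ≥ 1` and any `λ ≤ p` on the grid `Q(d)` (in
particular any `λ ≤ p_{min,Q}`): `p − λ + (1/d) Σ_{i∈I₊} Aᵢᵢ ∈ H_r(g)` with `r = max(dn, 2)` —
«(i) follows directly from (2.3)»: `B_d(p − λ) ∈ H_{dn}(g)` and `q₁, q₂ ∈ H₂(g)`.  Equivalently
(cf. (iii)) the level-`max(dn,2)` Handelman LP certifies the lower bound `λ − (1/d)Σ_{I₊}Aᵢᵢ`.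
[cite: DeklerkLaurent2010, §2 Theorem 2.1 (i) (with its proof via (2.3))] -/
theorem isHandelmanCube_quadPoly_sub_C {d : ℕ} (hd : 0 < d) (A : Matrix ι ι 𝕜)
    (b : ι → 𝕜) (c : 𝕜) {lam : 𝕜}
    (hlam : ∀ k : ι → Fin (d + 1), lam ≤ eval (gridPt 𝕜 d k) (quadPoly A b c)) :
    IsHandelmanCube (max (d * Fintype.card ι) 2)
      (quadPoly A b c - C lam + C (posDiagSum A / d)) := by
  have hdpos : (0 : 𝕜) < 1 / (d : 𝕜) := by
    rw [one_div]; exact inv_pos.2 (by exact_mod_cast hd)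
  rw [quadPoly_sub_C_eq hd A b c lam, sub_add_cancel]
  refine IsHandelmanCube.add (IsHandelmanCube.add ?_ ?_) ?_
  · refine (isHandelmanCube_bernsteinOp fun k => ?_).mono (le_max_left _ _)
    rw [map_sub, eval_C]
    exact sub_nonneg.2 (hlam k)
  · refine (IsHandelmanCube.sum _ fun i _ => ?_).smul hdpos.le
    exact ((isHandelmanCube_X_mul_one_sub_X i).smul (le_max_right _ _)).mono (le_max_right _ _)
  · refine (IsHandelmanCube.sum _ fun i _ => ?_).smul hdpos.le
    exact ((isHandelmanCube_one_sub_X_sq_add_X i).smul (le_max_right _ _)).mono (le_max_right _ _)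

/-- **Theorem 2.1 (i)** with the hypothesis on all of `Q`: `λ ≤ p` on `Q` ⇒
`p − λ + (1/d)Σ_{I₊}Aᵢᵢ ∈ H_{max(dn,2)}(g)`; so (by soundness) `p_{min,Q} − p^{(max(dn,2))}_{han} ≤
(1/d) Σ_{I₊} Aᵢᵢ` (the LP part of (iii), (2.4)).
[cite: DeklerkLaurent2010, §2 Theorem 2.1 (i), (iii) eq. (2.4)] -/
theorem isHandelmanCube_quadPoly_sub_C' {d : ℕ} (hd : 0 < d) (A : Matrix ι ι 𝕜)
    (b : ι → 𝕜) (c : 𝕜) {lam : 𝕜}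
    (hlam : ∀ x : ι → 𝕜, (∀ i, 0 ≤ x i) → (∀ i, x i ≤ 1) → lam ≤ eval x (quadPoly A b c)) :
    IsHandelmanCube (max (d * Fintype.card ι) 2)
      (quadPoly A b c - C (lam - posDiagSum A / d)) := by
  have h := isHandelmanCube_quadPoly_sub_C hd A b c
    (fun k => hlam _ (fun i => (gridPt_mem k i).1) (fun i => (gridPt_mem k i).2))
  have e : quadPoly A b c - C (lam - posDiagSum A / d) =
      quadPoly A b c - C lam + C (posDiagSum A / d) := by
    rw [map_sub]; ring
  rw [e]
  exact h

/-- **Theorem 2.1 (ii).**  If `p = xᵀAx + bᵀx + c` satisfies `p ≥ λ > 0` on `Q` and `d ≥ 1` is an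
integer with `Σ_{i∈I₊} Aᵢᵢ ≤ λ d` (e.g. `d = d_p = ⌈Σ_{I₊}Aᵢᵢ / p_{min,Q}⌉`, or `d = 1` if that is `0`),
then `p ∈ H_r(g)` with `r = max(dn, 2)` — an explicit Handelman (LP) certificate of positivity on the
hypercube of a priori bounded degree («after choosing for `d` the smallest integer making the
constant `p_{min,Q} − (1/d)Σ_{I₊}Aᵢᵢ` nonnegative»).
[cite: DeklerkLaurent2010, §2 Theorem 2.1 (ii)] -/
theorem isHandelmanCube_quadPoly_of_pos {d : ℕ} (hd : 0 < d) (A : Matrix ι ι 𝕜)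
    (b : ι → 𝕜) (c : 𝕜) {lam : 𝕜}
    (hlam : ∀ x : ι → 𝕜, (∀ i, 0 ≤ x i) → (∀ i, x i ≤ 1) → lam ≤ eval x (quadPoly A b c))
    (hdlam : posDiagSum A ≤ lam * d) :
    IsHandelmanCube (max (d * Fintype.card ι) 2) (quadPoly A b c) := by
  have h := isHandelmanCube_quadPoly_sub_C' hd A b c hlam
  have hconst : 0 ≤ lam - posDiagSum A / d := by
    rw [sub_nonneg, div_le_iff₀ (by exact_mod_cast hd)]
    exact hdlam
  have h2 := h.add (isHandelmanCube_C (r := max (d * Fintype.card ι) 2) hconst)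
  rwa [sub_add_cancel] at h2

/-- **Theorem 2.1 (iv)** (printed for `d ≥ 2`; the argument works for every `d ≥ 1`): some grid point
`k/d ∈ Q(d)` has `p(k/d) ≤ p(x) + (1/(4d)) Σ_{I₊} Aᵢᵢ` for every `x ∈ Q`, i.e.
`p_{min,Q(d)} − p_{min,Q} ≤ (1/(4d)) Σ_{I₊} Aᵢᵢ`.  Proof as printed: `p = B_d(p) + q₁ + q₂ − C(d,p)`
with `B_d(p) ≥ p_{min,Q(d)}`, `q₁ ≥ 0` and `q₂ ≥ (3/4) C(d,p)` on `Q` («`(xᵢ − 1)² + xᵢ ≥ 3/4`»).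
[cite: DeklerkLaurent2010, §2 Theorem 2.1 (iv) eq. (2.5) (with its proof, p. 9)] -/
theorem exists_grid_eval_le {d : ℕ} (hd : 0 < d) (A : Matrix ι ι 𝕜) (b : ι → 𝕜)
    (c : 𝕜) :
    ∃ k : ι → Fin (d + 1), ∀ x : ι → 𝕜, (∀ i, 0 ≤ x i) → (∀ i, x i ≤ 1) →
      eval (gridPt 𝕜 d k) (quadPoly A b c) ≤ eval x (quadPoly A b c) + posDiagSum A / (4 * d) := by
  classical
  -- the grid minimiser
  obtain ⟨k, -, hk⟩ := Finset.exists_min_image (Finset.univ : Finset (ι → Fin (d + 1)))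
    (fun k => eval (gridPt 𝕜 d k) (quadPoly A b c)) ⟨fun _ => 0, Finset.mem_univ _⟩
  refine ⟨k, fun x hx0 hx1 => ?_⟩
  set p := quadPoly A b c with hp
  set μ := eval (gridPt 𝕜 d k) p with hμ
  have hB : μ ≤ eval x (bernsteinOp d p) :=
    le_eval_bernsteinOp (fun k' => hk k' (Finset.mem_univ _)) hx0 hx1
  have hid := quadPoly_sub_C_eq hd A b c 0
  rw [map_zero, sub_zero, ← hp] at hid
  have hdpos : (0 : 𝕜) < (d : 𝕜) := by exact_mod_cast hd
  -- evaluate the identity at `x`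
  have hq1 : 0 ≤ eval x (C (1 / (d : 𝕜)) * ∑ i, C (max (-A i i) 0) * (X i * (1 - X i))) := by
    rw [map_mul, eval_C, map_sum]
    refine mul_nonneg (by positivity) (Finset.sum_nonneg fun i _ => ?_)
    rw [map_mul, eval_C, map_mul, map_sub, map_one, eval_X]
    exact mul_nonneg (le_max_right _ _) (mul_nonneg (hx0 i) (sub_nonneg.2 (hx1 i)))
  have hq2 : 3 / 4 * (posDiagSum A / d) ≤
      eval x (C (1 / (d : 𝕜)) * ∑ i, C (max (A i i) 0) * ((1 - X i) ^ 2 + X i)) := by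
    rw [map_mul, eval_C, map_sum]
    have hterm : ∀ i, max (A i i) 0 * (3 / 4) ≤
        eval x (C (max (A i i) 0) * ((1 - X i) ^ 2 + X i) : MvPolynomial ι 𝕜) := by
      intro i
      rw [map_mul, eval_C, map_add, map_pow, map_sub, map_one, eval_X]
      exact mul_le_mul_of_nonneg_left (by nlinarith [sq_nonneg (x i - 1 / 2)]) (le_max_right _ _)
    have hs := Finset.sum_le_sum fun i (_ : i ∈ Finset.univ) => hterm i
    rw [← Finset.sum_mul] at hs
    unfold posDiagSum
    have hd' : (0 : 𝕜) ≤ 1 / (d : 𝕜) := by positivity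
    calc 3 / 4 * ((∑ i, max (A i i) 0) / (d : 𝕜))
        = 1 / (d : 𝕜) * ((∑ i, max (A i i) 0) * (3 / 4)) := by ring
      _ ≤ 1 / (d : 𝕜) * ∑ i, eval x (C (max (A i i) 0) * ((1 - X i) ^ 2 + X i) :
          MvPolynomial ι 𝕜) := mul_le_mul_of_nonneg_left hs hd'
  have hx := congrArg (eval x) hid
  rw [map_sub, map_add, map_add, eval_C] at hx
  have h4 : posDiagSum A / (4 * d) = (posDiagSum A / d) / 4 := by rw [div_div, mul_comm]
  rw [h4]
  linarith [posDiagSum_nonneg A]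

end Literature.Algebra.Polynomial.HandelmanHypercubeQuadratic

end
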